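import Summits.ResolutionOfSingularities.ResolutionOfSingularities.Theorems.FrobeniusLadderFInjectiveMacaulayficationQ6CNCharts
import Summits.ResolutionOfSingularities.ResolutionOfSingularities.Theorems.FrobeniusLadderFInjectiveMacaulayficationFaceFPureOfMonomialPCoeff
import HarnessLib

/-!
# Q6CN FACES: Fedder's test at every torus point for the 17 initial forms of `f₂` (hypothesis `hCN`, face by face)
# (crux `FInjectiveMacaulayfication`, calibration `stub_q6CNFiModel_char5`; data of record = idea-2 `Q6-fan.json` 4c41e681b86ed32f
# §(7): every face has a SINGLETON `p`-class with unit coefficient; CRUX-PLAN v7 R7.3′, seat res-L1-w45a-stub-3 = Q6CN typer;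
# file GENERATED by `work/q6/gen/gen_faces.py` — the expansions `F⁴` are recomputed by the script over `ℤ` and checked by `ring`)

Support file for crux stmt-ResolutionOfSingularities-15315. [OURS · L1 W4.5a] — NOT a statement of the manuscript; AI-written
(script-generated), weaker than expert review.

* `sum_fiberwise_list`, `faceFPure_of_monomial_pcoeff_list` — LIST form of the singleton-class criterion C5′
  (`FaceFPureOfMonomialPCoeff.fedder_of_aeval_expand_ne_zero`): `F^(p-1) = C u·x^γ₀ + Σ_(q ∈ M) C q.2·x^(q.1)`, `u ≠ 0`, every `q.1`
  differs from `γ₀` mod `p` in some coordinate ⟹ Fedder's test for `F ⊗ K` at every torus point of every field `K ⊇ k`;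
* `face_0` … `face_16` — the 17 faces of `f₂` (`z⁶`, `z⁶+y³z³`, `(x³+z³)(y³+z³)`, …, `x⁸`), each by `ring` (the expansion) + `decide`
  (the classes). [folklore]
-/

-- single-problem summit: the doubled namespace component is forced
set_option linter.dupNamespace false

noncomputable section

namespace Summit.ResolutionOfSingularities.ResolutionOfSingularities.Theorems.FInjectiveMacaulayfication.Q6CNFaces

open Summit.ResolutionOfSingularities.ResolutionOfSingularities.Theorems.FInjectiveMacaulayfication

/-! ## The list form of the singleton-class criterion -/

/-- Fiberwise regrouping of a list sum along a key into a finite type. [folklore] -/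
theorem sum_fiberwise_list {ι κ M : Type} [Fintype κ] [DecidableEq κ] [AddCommMonoid M] (key : ι → κ) (g : ι → M) :
    ∀ l : List ι, ∑ a : κ, ((l.filter fun x => key x = a).map g).sum = (l.map g).sum := by
  intro l
  induction l with
  | nil => simp
  | cons x l ih =>
    rw [List.map_cons, List.sum_cons, ← ih]
    have h : ∀ a : κ, ((List.filter (fun y => key y = a) (x :: l)).map g).sum =
        (if key x = a then g x else 0) + ((l.filter fun y => key y = a).map g).sum := by
      intro a
      rw [List.filter_cons]
      by_cases hxa : key x = a
      · rw [decide_eq_true hxa, if_pos hxa]; simp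
      · rw [decide_eq_false hxa, if_neg hxa]; simp
    simp only [h, Finset.sum_add_distrib, Finset.sum_ite_eq, Finset.mem_univ, if_true]

/-- **SINGLETON-CLASS CRITERION, list form.** [folklore] -/
theorem faceFPure_of_monomial_pcoeff_list (p : ℕ) [Fact p.Prime] {k : Type} [Field k] [CharP k p] {n : ℕ}
    (F : MvPolynomial (Fin n) k) (u : k) (hu : u ≠ 0) (γ₀ : Fin n → ℕ) (M : List ((Fin n → ℕ) × k))
    (hF : F ^ (p - 1) = MvPolynomial.C u * MvPolynomial.monomial (Finsupp.equivFunOnFinite.symm γ₀) 1 +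
      (M.map fun q => MvPolynomial.C q.2 * MvPolynomial.monomial (Finsupp.equivFunOnFinite.symm q.1) 1).sum)
    (hL : ∀ v ∈ M.map Prod.fst, ∃ i : Fin n, v i % p ≠ γ₀ i % p) :
    ∀ (K : Type) [Field K] [Algebra k K] (b : Fin n → K), (∀ i, b i ≠ 0) →
      (MvPolynomial.map (algebraMap k K) F) ^ (p - 1) ∉
        Ideal.span (Set.range fun i : Fin n => (MvPolynomial.X i - MvPolynomial.C (b i)) ^ p) := by
  intro K _ _ b hb
  classical
  have hp : 0 < p := (Fact.out : p.Prime).pos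
  let cls : (Fin n → ℕ) → (Fin n → Fin p) := fun γ j => ⟨γ j % p, Nat.mod_lt _ hp⟩
  let quo : (Fin n → ℕ) → (Fin n →₀ ℕ) := fun γ => Finsupp.equivFunOnFinite.symm fun j => γ j / p
  have hmon : ∀ γ : Fin n → ℕ, MvPolynomial.expand p (MvPolynomial.monomial (quo γ) (1 : k)) *
      MvPolynomial.monomial (Finsupp.equivFunOnFinite.symm fun j => ((cls γ j : ℕ))) 1 =
      MvPolynomial.monomial (Finsupp.equivFunOnFinite.symm γ) 1 :=
    fun γ => FaceFPureOfMonomialPCoeff.expand_monomial_mul_monomial_cls p hp (Finsupp.equivFunOnFinite.symm γ)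
  let c : (Fin n → Fin p) → MvPolynomial (Fin n) k := fun α =>
    (if cls γ₀ = α then MvPolynomial.C u * MvPolynomial.monomial (quo γ₀) 1 else 0) +
      ((M.filter fun q => cls q.1 = α).map fun q => MvPolynomial.C q.2 * MvPolynomial.monomial (quo q.1) 1).sum
  have hdec : F ^ (p - 1) = ∑ α : Fin n → Fin p, MvPolynomial.expand p (c α) *
      MvPolynomial.monomial (Finsupp.equivFunOnFinite.symm fun j => ((α j : ℕ))) 1 := by
    rw [hF]
    have h1 : ∀ α : Fin n → Fin p, MvPolynomial.expand p (c α) *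
        MvPolynomial.monomial (Finsupp.equivFunOnFinite.symm fun j => ((α j : ℕ))) (1 : k) =
        (if cls γ₀ = α then MvPolynomial.C u * MvPolynomial.monomial (Finsupp.equivFunOnFinite.symm γ₀) 1 else 0) +
          ((M.filter fun q => cls q.1 = α).map fun q =>
            MvPolynomial.C q.2 * MvPolynomial.monomial (Finsupp.equivFunOnFinite.symm q.1) 1).sum := by
      intro α
      simp only [c, map_add, add_mul]
      congr 1
      · split_ifs with h
        · subst h
          rw [map_mul, MvPolynomial.expand_C, mul_assoc, hmon]
        · rw [map_zero, zero_mul]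
      · rw [map_list_sum, List.map_map, ← List.sum_map_mul_right]
        refine congrArg _ (List.map_congr_left fun q hq => ?_)
        rw [List.mem_filter] at hq
        have hq2 : cls q.1 = α := of_decide_eq_true hq.2
        simp only [Function.comp_apply]
        rw [map_mul, MvPolynomial.expand_C, mul_assoc, ← hq2, hmon]
    simp only [h1, Finset.sum_add_distrib]
    congr 1
    · rw [Finset.sum_ite_eq Finset.univ (cls γ₀), if_pos (Finset.mem_univ _)]
    · exact (sum_fiberwise_list (fun q : (Fin n → ℕ) × k => cls q.1)
        (fun q => MvPolynomial.C q.2 * MvPolynomial.monomial (Finsupp.equivFunOnFinite.symm q.1) (1 : k)) M).symm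
  refine FaceFPureOfMonomialPCoeff.fedder_of_aeval_expand_ne_zero p F c hdec b ⟨cls γ₀, ?_⟩
  have hempty : (M.filter fun q => cls q.1 = cls γ₀) = [] := by
    rw [List.filter_eq_nil_iff]
    intro q hq h
    obtain ⟨i, hi⟩ := hL q.1 (List.mem_map.mpr ⟨q, hq, rfl⟩)
    have h' : cls q.1 = cls γ₀ := of_decide_eq_true h
    exact hi (by simpa [cls] using congrArg (fun f : Fin n → Fin p => ((f i : ℕ))) h')
  have hc0 : c (cls γ₀) = MvPolynomial.C u * MvPolynomial.monomial (quo γ₀) 1 := by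
    change (if cls γ₀ = cls γ₀ then _ else _) + _ = _
    rw [if_pos rfl, hempty, List.map_nil, List.sum_nil, add_zero]
  rw [hc0, map_mul, MvPolynomial.expand_C, MvPolynomial.expand_monomial, map_mul, MvPolynomial.aeval_C,
    MvPolynomial.aeval_monomial, map_one, one_mul]
  refine mul_ne_zero ((map_ne_zero_iff _ (algebraMap k K).injective).mpr hu) ?_
  rw [Finsupp.prod]
  exact Finset.prod_ne_zero_iff.mpr fun i _ => pow_ne_zero _ (hb i)

/-! ## The 17 faces of `f₂` -/

variable {k : Type} [Field k] [CharP k 5]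

/-- **Face 0: `z^6`** — Fedder's test at every torus point (singleton class `x^[0, 0, 24]` of `F⁴`). -/
theorem face_0 : ∀ (K : Type) [Field K] [Algebra k K] (b : Fin 3 → K), (∀ i, b i ≠ 0) →
    (MvPolynomial.map (algebraMap k K) ((([![0, 0, 6]] : List (Fin 3 → ℕ))).map fun e => (MvPolynomial.monomial (Finsupp.equivFunOnFinite.symm e) (1 : k) : MvPolynomial (Fin 3) k)).sum) ^ (5 - 1) ∉
      Ideal.span (Set.range fun i : Fin 3 => (MvPolynomial.X i - MvPolynomial.C (b i)) ^ 5) := by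
  haveI : Fact (Nat.Prime 5) := ⟨Nat.prime_five⟩
  refine faceFPure_of_monomial_pcoeff_list 5 _ (1 : k) one_ne_zero (![0, 0, 24] : Fin 3 → ℕ) ([] : List ((Fin 3 → ℕ) × k)) ?_
    (by show ∀ v ∈ ([] : List (Fin 3 → ℕ)), ∃ i : Fin 3, v i % 5 ≠ (![0, 0, 24] : Fin 3 → ℕ) i % 5; decide)
  simp only [List.map, List.sum_cons, List.sum_nil, Q6CNCharts.monomial_symm_vec3, map_one, one_mul]
  ring

/-- **Face 1: `z^6 + y^3*z^3`** — Fedder's test at every torus point (singleton class `x^[0, 12, 12]` of `F⁴`). -/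
theorem face_1 : ∀ (K : Type) [Field K] [Algebra k K] (b : Fin 3 → K), (∀ i, b i ≠ 0) →
    (MvPolynomial.map (algebraMap k K) ((([![0, 3, 3], ![0, 0, 6]] : List (Fin 3 → ℕ))).map fun e => (MvPolynomial.monomial (Finsupp.equivFunOnFinite.symm e) (1 : k) : MvPolynomial (Fin 3) k)).sum) ^ (5 - 1) ∉
      Ideal.span (Set.range fun i : Fin 3 => (MvPolynomial.X i - MvPolynomial.C (b i)) ^ 5) := by
  haveI : Fact (Nat.Prime 5) := ⟨Nat.prime_five⟩
  refine faceFPure_of_monomial_pcoeff_list 5 _ (1 : k) one_ne_zero (![0, 12, 12] : Fin 3 → ℕ) ([(![0, 0, 24], (1 : k)), (![0, 3, 21], (4 : k)), (![0, 6, 18], (6 : k)), (![0, 9, 15], (4 : k))] : List ((Fin 3 → ℕ) × k)) ?_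
    (by show ∀ v ∈ ([![0, 0, 24], ![0, 3, 21], ![0, 6, 18], ![0, 9, 15]] : List (Fin 3 → ℕ)), ∃ i : Fin 3, v i % 5 ≠ (![0, 12, 12] : Fin 3 → ℕ) i % 5; decide)
  simp only [List.map, List.sum_cons, List.sum_nil, Q6CNCharts.monomial_symm_vec3, map_one, one_mul, map_ofNat]
  ring

/-- **Face 2: `z^6 + y^3*z^3 + x^3*z^3 + x^3*y^3`** — Fedder's test at every torus point (singleton class `x^[12, 12, 0]` of `F⁴`). -/
theorem face_2 : ∀ (K : Type) [Field K] [Algebra k K] (b : Fin 3 → K), (∀ i, b i ≠ 0) →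
    (MvPolynomial.map (algebraMap k K) ((([![3, 3, 0], ![3, 0, 3], ![0, 3, 3], ![0, 0, 6]] : List (Fin 3 → ℕ))).map fun e => (MvPolynomial.monomial (Finsupp.equivFunOnFinite.symm e) (1 : k) : MvPolynomial (Fin 3) k)).sum) ^ (5 - 1) ∉
      Ideal.span (Set.range fun i : Fin 3 => (MvPolynomial.X i - MvPolynomial.C (b i)) ^ 5) := by
  haveI : Fact (Nat.Prime 5) := ⟨Nat.prime_five⟩
  refine faceFPure_of_monomial_pcoeff_list 5 _ (1 : k) one_ne_zero (![12, 12, 0] : Fin 3 → ℕ) ([(![0, 0, 24], (1 : k)), (![0, 3, 21], (4 : k)), (![0, 6, 18], (6 : k)), (![0, 9, 15], (4 : k)), (![0, 12, 12], (1 : k)), (![3, 0, 21], (4 : k)), (![3, 3, 18], (16 : k)), (![3, 6, 15], (24 : k)), (![3, 9, 12], (16 : k)), (![3, 12, 9], (4 : k)), (![6, 0, 18], (6 : k)), (![6, 3, 15], (24 : k)), (![6, 6, 12], (36 : k)), (![6, 9, 9], (24 : k)), (![6, 12, 6], (6 : k)), (![9, 0, 15], (4 : k)), (![9, 3, 12],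 (16 : k)), (![9, 6, 9], (24 : k)), (![9, 9, 6], (16 : k)), (![9, 12, 3], (4 : k)), (![12, 0, 12], (1 : k)), (![12, 3, 9], (4 : k)), (![12, 6, 6], (6 : k)), (![12, 9, 3], (4 : k))] : List ((Fin 3 → ℕ) × k)) ?_
    (by show ∀ v ∈ ([![0, 0, 24], ![0, 3, 21], ![0, 6, 18], ![0, 9, 15], ![0, 12, 12], ![3, 0, 21], ![3, 3, 18], ![3, 6, 15], ![3, 9, 12], ![3, 12, 9], ![6, 0, 18], ![6, 3, 15], ![6, 6, 12], ![6, 9, 9], ![6, 12, 6], ![9, 0, 15], ![9, 3, 12], ![9, 6, 9], ![9, 9, 6], ![9, 12, 3], ![12, 0, 12], ![12, 3, 9], ![12, 6, 6], ![12, 9, 3]] : List (Fin 3 → ℕ)), ∃ i : Fin 3, v i % 5 ≠ (![12, 12, 0] : Fin 3 → ℕ) i % 5; decide)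
  simp only [List.map, List.sum_cons, List.sum_nil, Q6CNCharts.monomial_symm_vec3, map_one, one_mul, map_ofNat]
  ring

/-- **Face 3: `z^6 + x^3*z^3`** — Fedder's test at every torus point (singleton class `x^[12, 0, 12]` of `F⁴`). -/
theorem face_3 : ∀ (K : Type) [Field K] [Algebra k K] (b : Fin 3 → K), (∀ i, b i ≠ 0) →
    (MvPolynomial.map (algebraMap k K) ((([![3, 0, 3], ![0, 0, 6]] : List (Fin 3 → ℕ))).map fun e => (MvPolynomial.monomial (Finsupp.equivFunOnFinite.symm e) (1 : k) : MvPolynomial (Fin 3) k)).sum) ^ (5 - 1) ∉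
      Ideal.span (Set.range fun i : Fin 3 => (MvPolynomial.X i - MvPolynomial.C (b i)) ^ 5) := by
  haveI : Fact (Nat.Prime 5) := ⟨Nat.prime_five⟩
  refine faceFPure_of_monomial_pcoeff_list 5 _ (1 : k) one_ne_zero (![12, 0, 12] : Fin 3 → ℕ) ([(![0, 0, 24], (1 : k)), (![3, 0, 21], (4 : k)), (![6, 0, 18], (6 : k)), (![9, 0, 15], (4 : k))] : List ((Fin 3 → ℕ) × k)) ?_
    (by show ∀ v ∈ ([![0, 0, 24], ![3, 0, 21], ![6, 0, 18], ![9, 0, 15]] : List (Fin 3 → ℕ)), ∃ i : Fin 3, v i % 5 ≠ (![12, 0, 12] : Fin 3 → ℕ) i % 5; decide)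
  simp only [List.map, List.sum_cons, List.sum_nil, Q6CNCharts.monomial_symm_vec3, map_one, one_mul, map_ofNat]
  ring

/-- **Face 4: `y^3*z^3`** — Fedder's test at every torus point (singleton class `x^[0, 12, 12]` of `F⁴`). -/
theorem face_4 : ∀ (K : Type) [Field K] [Algebra k K] (b : Fin 3 → K), (∀ i, b i ≠ 0) →
    (MvPolynomial.map (algebraMap k K) ((([![0, 3, 3]] : List (Fin 3 → ℕ))).map fun e => (MvPolynomial.monomial (Finsupp.equivFunOnFinite.symm e) (1 : k) : MvPolynomial (Fin 3) k)).sum) ^ (5 - 1) ∉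
      Ideal.span (Set.range fun i : Fin 3 => (MvPolynomial.X i - MvPolynomial.C (b i)) ^ 5) := by
  haveI : Fact (Nat.Prime 5) := ⟨Nat.prime_five⟩
  refine faceFPure_of_monomial_pcoeff_list 5 _ (1 : k) one_ne_zero (![0, 12, 12] : Fin 3 → ℕ) ([] : List ((Fin 3 → ℕ) × k)) ?_
    (by show ∀ v ∈ ([] : List (Fin 3 → ℕ)), ∃ i : Fin 3, v i % 5 ≠ (![0, 12, 12] : Fin 3 → ℕ) i % 5; decide)
  simp only [List.map, List.sum_cons, List.sum_nil, Q6CNCharts.monomial_symm_vec3, map_one, one_mul]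
  ring

/-- **Face 5: `y^3*z^3 + y^8`** — Fedder's test at every torus point (singleton class `x^[0, 12, 12]` of `F⁴`). -/
theorem face_5 : ∀ (K : Type) [Field K] [Algebra k K] (b : Fin 3 → K), (∀ i, b i ≠ 0) →
    (MvPolynomial.map (algebraMap k K) ((([![0, 3, 3], ![0, 8, 0]] : List (Fin 3 → ℕ))).map fun e => (MvPolynomial.monomial (Finsupp.equivFunOnFinite.symm e) (1 : k) : MvPolynomial (Fin 3) k)).sum) ^ (5 - 1) ∉
      Ideal.span (Set.range fun i : Fin 3 => (MvPolynomial.X i - MvPolynomial.C (b i)) ^ 5) := by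
  haveI : Fact (Nat.Prime 5) := ⟨Nat.prime_five⟩
  refine faceFPure_of_monomial_pcoeff_list 5 _ (1 : k) one_ne_zero (![0, 12, 12] : Fin 3 → ℕ) ([(![0, 17, 9], (4 : k)), (![0, 22, 6], (6 : k)), (![0, 27, 3], (4 : k)), (![0, 32, 0], (1 : k))] : List ((Fin 3 → ℕ) × k)) ?_
    (by show ∀ v ∈ ([![0, 17, 9], ![0, 22, 6], ![0, 27, 3], ![0, 32, 0]] : List (Fin 3 → ℕ)), ∃ i : Fin 3, v i % 5 ≠ (![0, 12, 12] : Fin 3 → ℕ) i % 5; decide)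
  simp only [List.map, List.sum_cons, List.sum_nil, Q6CNCharts.monomial_symm_vec3, map_one, one_mul, map_ofNat]
  ring

/-- **Face 6: `y^3*z^3 + y^8 + x^3*y^3`** — Fedder's test at every torus point (singleton class `x^[12, 12, 0]` of `F⁴`). -/
theorem face_6 : ∀ (K : Type) [Field K] [Algebra k K] (b : Fin 3 → K), (∀ i, b i ≠ 0) →
    (MvPolynomial.map (algebraMap k K) ((([![3, 3, 0], ![0, 3, 3], ![0, 8, 0]] : List (Fin 3 → ℕ))).map fun e => (MvPolynomial.monomial (Finsupp.equivFunOnFinite.symm e) (1 : k) : MvPolynomial (Fin 3) k)).sum) ^ (5 - 1) ∉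
      Ideal.span (Set.range fun i : Fin 3 => (MvPolynomial.X i - MvPolynomial.C (b i)) ^ 5) := by
  haveI : Fact (Nat.Prime 5) := ⟨Nat.prime_five⟩
  refine faceFPure_of_monomial_pcoeff_list 5 _ (1 : k) one_ne_zero (![12, 12, 0] : Fin 3 → ℕ) ([(![0, 12, 12], (1 : k)), (![0, 17, 9], (4 : k)), (![0, 22, 6], (6 : k)), (![0, 27, 3], (4 : k)), (![0, 32, 0], (1 : k)), (![3, 12, 9], (4 : k)), (![3, 17, 6], (12 : k)), (![3, 22, 3], (12 : k)), (![3, 27, 0], (4 : k)), (![6, 12, 6], (6 : k)), (![6, 17, 3], (12 : k)), (![6, 22, 0], (6 : k)), (![9, 12, 3], (4 : k)), (![9, 17, 0], (4 : k))] : List ((Fin 3 → ℕ) × k)) ?_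
    (by show ∀ v ∈ ([![0, 12, 12], ![0, 17, 9], ![0, 22, 6], ![0, 27, 3], ![0, 32, 0], ![3, 12, 9], ![3, 17, 6], ![3, 22, 3], ![3, 27, 0], ![6, 12, 6], ![6, 17, 3], ![6, 22, 0], ![9, 12, 3], ![9, 17, 0]] : List (Fin 3 → ℕ)), ∃ i : Fin 3, v i % 5 ≠ (![12, 12, 0] : Fin 3 → ℕ) i % 5; decide)
  simp only [List.map, List.sum_cons, List.sum_nil, Q6CNCharts.monomial_symm_vec3, map_one, one_mul, map_ofNat]
  ring

/-- **Face 7: `y^3*z^3 + x^3*y^3`** — Fedder's test at every torus point (singleton class `x^[12, 12, 0]` of `F⁴`). -/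
theorem face_7 : ∀ (K : Type) [Field K] [Algebra k K] (b : Fin 3 → K), (∀ i, b i ≠ 0) →
    (MvPolynomial.map (algebraMap k K) ((([![3, 3, 0], ![0, 3, 3]] : List (Fin 3 → ℕ))).map fun e => (MvPolynomial.monomial (Finsupp.equivFunOnFinite.symm e) (1 : k) : MvPolynomial (Fin 3) k)).sum) ^ (5 - 1) ∉
      Ideal.span (Set.range fun i : Fin 3 => (MvPolynomial.X i - MvPolynomial.C (b i)) ^ 5) := by
  haveI : Fact (Nat.Prime 5) := ⟨Nat.prime_five⟩
  refine faceFPure_of_monomial_pcoeff_list 5 _ (1 : k) one_ne_zero (![12, 12, 0] : Fin 3 → ℕ) ([(![0, 12, 12], (1 : k)), (![3, 12, 9], (4 : k)), (![6, 12, 6], (6 : k)), (![9, 12, 3], (4 : k))] : List ((Fin 3 → ℕ) × k)) ?_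
    (by show ∀ v ∈ ([![0, 12, 12], ![3, 12, 9], ![6, 12, 6], ![9, 12, 3]] : List (Fin 3 → ℕ)), ∃ i : Fin 3, v i % 5 ≠ (![12, 12, 0] : Fin 3 → ℕ) i % 5; decide)
  simp only [List.map, List.sum_cons, List.sum_nil, Q6CNCharts.monomial_symm_vec3, map_one, one_mul, map_ofNat]
  ring

/-- **Face 8: `y^8`** — Fedder's test at every torus point (singleton class `x^[0, 32, 0]` of `F⁴`). -/
theorem face_8 : ∀ (K : Type) [Field K] [Algebra k K] (b : Fin 3 → K), (∀ i, b i ≠ 0) →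
    (MvPolynomial.map (algebraMap k K) ((([![0, 8, 0]] : List (Fin 3 → ℕ))).map fun e => (MvPolynomial.monomial (Finsupp.equivFunOnFinite.symm e) (1 : k) : MvPolynomial (Fin 3) k)).sum) ^ (5 - 1) ∉
      Ideal.span (Set.range fun i : Fin 3 => (MvPolynomial.X i - MvPolynomial.C (b i)) ^ 5) := by
  haveI : Fact (Nat.Prime 5) := ⟨Nat.prime_five⟩
  refine faceFPure_of_monomial_pcoeff_list 5 _ (1 : k) one_ne_zero (![0, 32, 0] : Fin 3 → ℕ) ([] : List ((Fin 3 → ℕ) × k)) ?_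
    (by show ∀ v ∈ ([] : List (Fin 3 → ℕ)), ∃ i : Fin 3, v i % 5 ≠ (![0, 32, 0] : Fin 3 → ℕ) i % 5; decide)
  simp only [List.map, List.sum_cons, List.sum_nil, Q6CNCharts.monomial_symm_vec3, map_one, one_mul]
  ring

/-- **Face 9: `y^8 + x^3*y^3`** — Fedder's test at every torus point (singleton class `x^[12, 12, 0]` of `F⁴`). -/
theorem face_9 : ∀ (K : Type) [Field K] [Algebra k K] (b : Fin 3 → K), (∀ i, b i ≠ 0) →
    (MvPolynomial.map (algebraMap k K) ((([![3, 3, 0], ![0, 8, 0]] : List (Fin 3 → ℕ))).map fun e => (MvPolynomial.monomial (Finsupp.equivFunOnFinite.symm e) (1 : k) : MvPolynomial (Fin 3) k)).sum) ^ (5 - 1) ∉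
      Ideal.span (Set.range fun i : Fin 3 => (MvPolynomial.X i - MvPolynomial.C (b i)) ^ 5) := by
  haveI : Fact (Nat.Prime 5) := ⟨Nat.prime_five⟩
  refine faceFPure_of_monomial_pcoeff_list 5 _ (1 : k) one_ne_zero (![12, 12, 0] : Fin 3 → ℕ) ([(![0, 32, 0], (1 : k)), (![3, 27, 0], (4 : k)), (![6, 22, 0], (6 : k)), (![9, 17, 0], (4 : k))] : List ((Fin 3 → ℕ) × k)) ?_
    (by show ∀ v ∈ ([![0, 32, 0], ![3, 27, 0], ![6, 22, 0], ![9, 17, 0]] : List (Fin 3 → ℕ)), ∃ i : Fin 3, v i % 5 ≠ (![12, 12, 0] : Fin 3 → ℕ) i % 5; decide)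
  simp only [List.map, List.sum_cons, List.sum_nil, Q6CNCharts.monomial_symm_vec3, map_one, one_mul, map_ofNat]
  ring

/-- **Face 10: `x^3*z^3`** — Fedder's test at every torus point (singleton class `x^[12, 0, 12]` of `F⁴`). -/
theorem face_10 : ∀ (K : Type) [Field K] [Algebra k K] (b : Fin 3 → K), (∀ i, b i ≠ 0) →
    (MvPolynomial.map (algebraMap k K) ((([![3, 0, 3]] : List (Fin 3 → ℕ))).map fun e => (MvPolynomial.monomial (Finsupp.equivFunOnFinite.symm e) (1 : k) : MvPolynomial (Fin 3) k)).sum) ^ (5 - 1) ∉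
      Ideal.span (Set.range fun i : Fin 3 => (MvPolynomial.X i - MvPolynomial.C (b i)) ^ 5) := by
  haveI : Fact (Nat.Prime 5) := ⟨Nat.prime_five⟩
  refine faceFPure_of_monomial_pcoeff_list 5 _ (1 : k) one_ne_zero (![12, 0, 12] : Fin 3 → ℕ) ([] : List ((Fin 3 → ℕ) × k)) ?_
    (by show ∀ v ∈ ([] : List (Fin 3 → ℕ)), ∃ i : Fin 3, v i % 5 ≠ (![12, 0, 12] : Fin 3 → ℕ) i % 5; decide)
  simp only [List.map, List.sum_cons, List.sum_nil, Q6CNCharts.monomial_symm_vec3, map_one, one_mul]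
  ring

/-- **Face 11: `x^3*z^3 + x^3*y^3`** — Fedder's test at every torus point (singleton class `x^[12, 12, 0]` of `F⁴`). -/
theorem face_11 : ∀ (K : Type) [Field K] [Algebra k K] (b : Fin 3 → K), (∀ i, b i ≠ 0) →
    (MvPolynomial.map (algebraMap k K) ((([![3, 3, 0], ![3, 0, 3]] : List (Fin 3 → ℕ))).map fun e => (MvPolynomial.monomial (Finsupp.equivFunOnFinite.symm e) (1 : k) : MvPolynomial (Fin 3) k)).sum) ^ (5 - 1) ∉
      Ideal.span (Set.range fun i : Fin 3 => (MvPolynomial.X i - MvPolynomial.C (b i)) ^ 5) := by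
  haveI : Fact (Nat.Prime 5) := ⟨Nat.prime_five⟩
  refine faceFPure_of_monomial_pcoeff_list 5 _ (1 : k) one_ne_zero (![12, 12, 0] : Fin 3 → ℕ) ([(![12, 0, 12], (1 : k)), (![12, 3, 9], (4 : k)), (![12, 6, 6], (6 : k)), (![12, 9, 3], (4 : k))] : List ((Fin 3 → ℕ) × k)) ?_
    (by show ∀ v ∈ ([![12, 0, 12], ![12, 3, 9], ![12, 6, 6], ![12, 9, 3]] : List (Fin 3 → ℕ)), ∃ i : Fin 3, v i % 5 ≠ (![12, 12, 0] : Fin 3 → ℕ) i % 5; decide)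
  simp only [List.map, List.sum_cons, List.sum_nil, Q6CNCharts.monomial_symm_vec3, map_one, one_mul, map_ofNat]
  ring

/-- **Face 12: `x^3*z^3 + x^3*y^3 + x^8`** — Fedder's test at every torus point (singleton class `x^[12, 12, 0]` of `F⁴`). -/
theorem face_12 : ∀ (K : Type) [Field K] [Algebra k K] (b : Fin 3 → K), (∀ i, b i ≠ 0) →
    (MvPolynomial.map (algebraMap k K) ((([![3, 3, 0], ![3, 0, 3], ![8, 0, 0]] : List (Fin 3 → ℕ))).map fun e => (MvPolynomial.monomial (Finsupp.equivFunOnFinite.symm e) (1 : k) : MvPolynomial (Fin 3) k)).sum) ^ (5 - 1) ∉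
      Ideal.span (Set.range fun i : Fin 3 => (MvPolynomial.X i - MvPolynomial.C (b i)) ^ 5) := by
  haveI : Fact (Nat.Prime 5) := ⟨Nat.prime_five⟩
  refine faceFPure_of_monomial_pcoeff_list 5 _ (1 : k) one_ne_zero (![12, 12, 0] : Fin 3 → ℕ) ([(![12, 0, 12], (1 : k)), (![12, 3, 9], (4 : k)), (![12, 6, 6], (6 : k)), (![12, 9, 3], (4 : k)), (![17, 0, 9], (4 : k)), (![17, 3, 6], (12 : k)), (![17, 6, 3], (12 : k)), (![17, 9, 0], (4 : k)), (![22, 0, 6], (6 : k)), (![22, 3, 3], (12 : k)), (![22, 6, 0], (6 : k)), (![27, 0, 3], (4 : k)), (![27, 3, 0], (4 : k)), (![32, 0, 0], (1 : k))] : List ((Fin 3 → ℕ) × k)) ?_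
    (by show ∀ v ∈ ([![12, 0, 12], ![12, 3, 9], ![12, 6, 6], ![12, 9, 3], ![17, 0, 9], ![17, 3, 6], ![17, 6, 3], ![17, 9, 0], ![22, 0, 6], ![22, 3, 3], ![22, 6, 0], ![27, 0, 3], ![27, 3, 0], ![32, 0, 0]] : List (Fin 3 → ℕ)), ∃ i : Fin 3, v i % 5 ≠ (![12, 12, 0] : Fin 3 → ℕ) i % 5; decide)
  simp only [List.map, List.sum_cons, List.sum_nil, Q6CNCharts.monomial_symm_vec3, map_one, one_mul, map_ofNat]
  ring

/-- **Face 13: `x^3*z^3 + x^8`** — Fedder's test at every torus point (singleton class `x^[12, 0, 12]` of `F⁴`). -/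
theorem face_13 : ∀ (K : Type) [Field K] [Algebra k K] (b : Fin 3 → K), (∀ i, b i ≠ 0) →
    (MvPolynomial.map (algebraMap k K) ((([![3, 0, 3], ![8, 0, 0]] : List (Fin 3 → ℕ))).map fun e => (MvPolynomial.monomial (Finsupp.equivFunOnFinite.symm e) (1 : k) : MvPolynomial (Fin 3) k)).sum) ^ (5 - 1) ∉
      Ideal.span (Set.range fun i : Fin 3 => (MvPolynomial.X i - MvPolynomial.C (b i)) ^ 5) := by
  haveI : Fact (Nat.Prime 5) := ⟨Nat.prime_five⟩
  refine faceFPure_of_monomial_pcoeff_list 5 _ (1 : k) one_ne_zero (![12, 0, 12] : Fin 3 → ℕ) ([(![17, 0, 9], (4 : k)), (![22, 0, 6], (6 : k)), (![27, 0, 3], (4 : k)), (![32, 0, 0], (1 : k))] : List ((Fin 3 → ℕ) × k)) ?_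
    (by show ∀ v ∈ ([![17, 0, 9], ![22, 0, 6], ![27, 0, 3], ![32, 0, 0]] : List (Fin 3 → ℕ)), ∃ i : Fin 3, v i % 5 ≠ (![12, 0, 12] : Fin 3 → ℕ) i % 5; decide)
  simp only [List.map, List.sum_cons, List.sum_nil, Q6CNCharts.monomial_symm_vec3, map_one, one_mul, map_ofNat]
  ring

/-- **Face 14: `x^3*y^3`** — Fedder's test at every torus point (singleton class `x^[12, 12, 0]` of `F⁴`). -/
theorem face_14 : ∀ (K : Type) [Field K] [Algebra k K] (b : Fin 3 → K), (∀ i, b i ≠ 0) →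
    (MvPolynomial.map (algebraMap k K) ((([![3, 3, 0]] : List (Fin 3 → ℕ))).map fun e => (MvPolynomial.monomial (Finsupp.equivFunOnFinite.symm e) (1 : k) : MvPolynomial (Fin 3) k)).sum) ^ (5 - 1) ∉
      Ideal.span (Set.range fun i : Fin 3 => (MvPolynomial.X i - MvPolynomial.C (b i)) ^ 5) := by
  haveI : Fact (Nat.Prime 5) := ⟨Nat.prime_five⟩
  refine faceFPure_of_monomial_pcoeff_list 5 _ (1 : k) one_ne_zero (![12, 12, 0] : Fin 3 → ℕ) ([] : List ((Fin 3 → ℕ) × k)) ?_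
    (by show ∀ v ∈ ([] : List (Fin 3 → ℕ)), ∃ i : Fin 3, v i % 5 ≠ (![12, 12, 0] : Fin 3 → ℕ) i % 5; decide)
  simp only [List.map, List.sum_cons, List.sum_nil, Q6CNCharts.monomial_symm_vec3, map_one, one_mul]
  ring

/-- **Face 15: `x^3*y^3 + x^8`** — Fedder's test at every torus point (singleton class `x^[12, 12, 0]` of `F⁴`). -/
theorem face_15 : ∀ (K : Type) [Field K] [Algebra k K] (b : Fin 3 → K), (∀ i, b i ≠ 0) →
    (MvPolynomial.map (algebraMap k K) ((([![3, 3, 0], ![8, 0, 0]] : List (Fin 3 → ℕ))).map fun e => (MvPolynomial.monomial (Finsupp.equivFunOnFinite.symm e) (1 : k) : MvPolynomial (Fin 3) k)).sum) ^ (5 - 1) ∉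
      Ideal.span (Set.range fun i : Fin 3 => (MvPolynomial.X i - MvPolynomial.C (b i)) ^ 5) := by
  haveI : Fact (Nat.Prime 5) := ⟨Nat.prime_five⟩
  refine faceFPure_of_monomial_pcoeff_list 5 _ (1 : k) one_ne_zero (![12, 12, 0] : Fin 3 → ℕ) ([(![17, 9, 0], (4 : k)), (![22, 6, 0], (6 : k)), (![27, 3, 0], (4 : k)), (![32, 0, 0], (1 : k))] : List ((Fin 3 → ℕ) × k)) ?_
    (by show ∀ v ∈ ([![17, 9, 0], ![22, 6, 0], ![27, 3, 0], ![32, 0, 0]] : List (Fin 3 → ℕ)), ∃ i : Fin 3, v i % 5 ≠ (![12, 12, 0] : Fin 3 → ℕ) i % 5; decide)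
  simp only [List.map, List.sum_cons, List.sum_nil, Q6CNCharts.monomial_symm_vec3, map_one, one_mul, map_ofNat]
  ring

/-- **Face 16: `x^8`** — Fedder's test at every torus point (singleton class `x^[32, 0, 0]` of `F⁴`). -/
theorem face_16 : ∀ (K : Type) [Field K] [Algebra k K] (b : Fin 3 → K), (∀ i, b i ≠ 0) →
    (MvPolynomial.map (algebraMap k K) ((([![8, 0, 0]] : List (Fin 3 → ℕ))).map fun e => (MvPolynomial.monomial (Finsupp.equivFunOnFinite.symm e) (1 : k) : MvPolynomial (Fin 3) k)).sum) ^ (5 - 1) ∉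
      Ideal.span (Set.range fun i : Fin 3 => (MvPolynomial.X i - MvPolynomial.C (b i)) ^ 5) := by
  haveI : Fact (Nat.Prime 5) := ⟨Nat.prime_five⟩
  refine faceFPure_of_monomial_pcoeff_list 5 _ (1 : k) one_ne_zero (![32, 0, 0] : Fin 3 → ℕ) ([] : List ((Fin 3 → ℕ) × k)) ?_
    (by show ∀ v ∈ ([] : List (Fin 3 → ℕ)), ∃ i : Fin 3, v i % 5 ≠ (![32, 0, 0] : Fin 3 → ℕ) i % 5; decide)
  simp only [List.map, List.sum_cons, List.sum_nil, Q6CNCharts.monomial_symm_vec3, map_one, one_mul]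
  ring

end Summit.ResolutionOfSingularities.ResolutionOfSingularities.Theorems.FInjectiveMacaulayfication.Q6CNFaces

end
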